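import Summits.CriticalPhenomena.PercolationContinuityZ3.Theorems.PercNonProliferationNonProliferationOfOneRatioThreeCrossers
import Summits.CriticalPhenomena.PercolationContinuityZ3.Theorems.PercNonProliferationNonProliferationStubSubshellCrossers
import Literature.Probability.Percolation.RSW
import HarnessLib

/-!
# Crux `PercNonProliferation.NonProliferation` (stmt-CriticalPhenomena-4444), line `avoidance-cost-covering` — calibration of the open stub

Helper file for the lead's skeleton of line `avoidance-cost-covering`: proves the registered stub
`oneRatioThreeCrossers_iff_shellThreeCrosserDecay`; lands with `--supports stmt-CriticalPhenomena-4444`.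

Write `Sh(a, c) := {v ∈ B(c) | ∃ l, a ≤ |v l|}` (closed shell of `ℤ³`) and `E₃(a, c)` for the event
"three points of `B(a)`, each joined INSIDE `Sh(a, c)` to `∂ⁱⁿB(c)`, pairwise not joined inside
`Sh(a, c)`", `P(a, c) := P_{p_c}(E₃(a, c))`. The line reduces the crux to the ONE-RATIO THREE-CROSSER
CRITERION `∃ k₀ ≥ 2, a₀ ≥ 1, q, (k₀+1)² q < 1 ∧ ∀ a ≥ a₀, P(a, k₀ a) ≤ q` (open stub
`stub_oneRatioThreeCrossers`). This file calibrates it: the criterion is EQUIVALENT to uniform power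
decay in the ratio with some exponent `> 2`,
`∃ a₀ ≥ 1, C, δ > 0, ∀ k ≥ 2, ∀ a ≥ a₀, P(a, k a) ≤ C k^{-(2+δ)}` ("`ζ₃ > 2`").

* decay ⇒ criterion: `C ≥ 0`; for `k₀ ≥ 2`, `(k₀+1)² C k₀^{-(2+δ)} ≤ (9/4) C k₀^{-δ} → 0`, so some
  `k₀ ≥ 2` has `(k₀+1)² q < 1` with `q := C k₀^{-(2+δ)}` (`ShellThreeCalibration.exists_ratio`).
* criterion ⇒ decay (the bootstrap): w.l.o.g. `q > 0` (replace `q` by `max q (1/(2(k₀+1)²))`).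
  Put `K := k₀ + 1`, `s := log_K (1/q)`, so `K^s = 1/q > K²`, `s > 2`; take `δ := s - 2`,
  `C := k₀^s`, i.e. `C k^{-(2+δ)} = (k₀/k)^s`. For `2 ≤ k < k₀`: `P ≤ 1 ≤ (k₀/k)^s`. For `k ≥ k₀`:
  sandwich `k₀ K^j ≤ k < k₀ K^{j+1}` (`j := log_K (k / k₀)`, `ShellThreeCalibration.ratio_sandwich`);
  outer-radius monotonicity `P(a, k a) ≤ P(a, k₀ K^j a)` (`ShellThreeCalibration.real_shellThree_anti`,
  from `stub_subshellCrossers` a.s.) and the landed ladder `real_shellThree_ladder` give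
  `P(a, k a) ≤ q^{j+1} = (1/K^{j+1})^s ≤ (k₀/k)^s`.
-/

noncomputable section

namespace Summit.CriticalPhenomena.PercolationContinuityZ3.Theorems.NonProliferation

open MeasureTheory Filter Topology
open Literature.Probability.LatticeModels Literature.Probability.Percolation

/-- The closed shell `Sh(a, c) = {v ∈ B(c) | ∃ l, a ≤ |v l|}` of `ℤ³` (local notation only). -/
local notation3 "Sh⟦" a ", " c "⟧" =>
  ({v : Site 3 | v ∈ box 3 c ∧ ∃ l : Fin 3, ((a : ℕ) : ℤ) ≤ |v l|} : Set (Site 3))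

/-- The shell three-crosser event `E₃(a, c)` of `ℤ³` (local notation only). -/
local notation3 "E₃⟦" a ", " c "⟧" =>
  ({ω : BondConfig (Site 3) | ∃ x : Fin (2 + 1) → Site 3, (∀ i, x i ∈ box 3 a) ∧
    (∀ i, ∃ y ∈ innerBoundary (zdGraph 3) (box 3 c), ω ∈ openConnIn Sh⟦a, c⟧ (x i) y) ∧
    ∀ i j, i ≠ j → ω ∉ openConnIn Sh⟦a, c⟧ (x i) (x j)} : Set (BondConfig (Site 3)))

namespace ShellThreeCalibration

open OneRatioThreeCrossers

/-- **Outer-radius monotonicity** (every `p`): for `a ≤ b ≤ c`, `P_p(E₃(a, c)) ≤ P_p(E₃(a, b))` —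
a.s. `ω ⊆ E(ℤ³)` (`ae_subset_edgeSet`), and then three shell-distinct crossers of `Sh(a, c)`
restrict to three of `Sh(a, b)` (first conjunct of `stub_subshellCrossers` with `b' = b`). -/
theorem real_shellThree_anti (p : unitInterval) {a b c : ℕ} (hab : a ≤ b) (hbc : b ≤ c) :
    (bondPercolation (zdGraph 3) p).real E₃⟦a, c⟧ ≤ (bondPercolation (zdGraph 3) p).real E₃⟦a, b⟧ := by
  have hincl : ∀ᵐ ω ∂(bondPercolation (zdGraph 3) p), ω ∈ E₃⟦a, c⟧ → ω ∈ E₃⟦a, b⟧ := by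
    filter_upwards [ae_subset_edgeSet (zdGraph 3) p] with ω hω hmem
    exact (stub_subshellCrossers 3 2 a b b c ω hab hbc hab hbc hω hmem).1
  simp only [measureReal_def]
  exact ENNReal.toReal_mono (measure_ne_top _ _) (measure_mono_ae hincl)

/-- **Choice of the ratio from power decay.** For `C ≥ 0` and `δ > 0` there is `k₀ ≥ 2` with
`(k₀+1)² · C k₀^{-(2+δ)} < 1`: indeed `(k₀+1)² k₀^{-2} ≤ 9/4` for `k₀ ≥ 2` and `k₀^{-δ} → 0`. -/
theorem exists_ratio {C δ : ℝ} (hC : 0 ≤ C) (hδ : 0 < δ) :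
    ∃ k₀ : ℕ, 2 ≤ k₀ ∧ ((k₀ : ℝ) + 1) ^ 2 * (C * (k₀ : ℝ) ^ (-(2 + δ))) < 1 := by
  have hlim : Tendsto (fun k : ℕ => 9 / 4 * C * (k : ℝ) ^ (-δ)) atTop (𝓝 0) := by
    have h := ((tendsto_rpow_neg_atTop hδ).comp tendsto_natCast_atTop_atTop).const_mul (9 / 4 * C)
    rw [mul_zero] at h
    exact h
  obtain ⟨k₀, hk₀, hsmall⟩ :=
    ((eventually_ge_atTop 2).and (hlim.eventually (eventually_lt_nhds one_pos))).exists
  refine ⟨k₀, hk₀, lt_of_le_of_lt ?_ hsmall⟩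
  have hk : (0 : ℝ) < k₀ := by exact_mod_cast (show 0 < k₀ by omega)
  have h2 : (2 : ℝ) ≤ k₀ := by exact_mod_cast hk₀
  have hsplit : (k₀ : ℝ) ^ (-(2 + δ)) = ((k₀ : ℝ) ^ 2)⁻¹ * (k₀ : ℝ) ^ (-δ) := by
    rw [neg_add, Real.rpow_add hk, Real.rpow_neg hk.le, Real.rpow_two]
  have hfrac : ((k₀ : ℝ) + 1) ^ 2 * ((k₀ : ℝ) ^ 2)⁻¹ ≤ 9 / 4 := by
    rw [← div_eq_mul_inv, div_le_iff₀ (by positivity)]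
    nlinarith
  have hnn : 0 ≤ C * (k₀ : ℝ) ^ (-δ) := mul_nonneg hC (Real.rpow_nonneg hk.le _)
  calc ((k₀ : ℝ) + 1) ^ 2 * (C * (k₀ : ℝ) ^ (-(2 + δ)))
      = (((k₀ : ℝ) + 1) ^ 2 * ((k₀ : ℝ) ^ 2)⁻¹) * (C * (k₀ : ℝ) ^ (-δ)) := by rw [hsplit]; ring
    _ ≤ 9 / 4 * (C * (k₀ : ℝ) ^ (-δ)) := mul_le_mul_of_nonneg_right hfrac hnn
    _ = 9 / 4 * C * (k₀ : ℝ) ^ (-δ) := by ring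

/-- **Geometric sandwich of a ratio.** For `1 ≤ k₀ ≤ k` there is `j` (namely
`j = log_{k₀+1} (k / k₀)`) with `k₀ (k₀+1)^j ≤ k < k₀ (k₀+1)^{j+1}`. -/
theorem ratio_sandwich {k₀ k : ℕ} (hk₀ : 1 ≤ k₀) (hk : k₀ ≤ k) :
    ∃ j : ℕ, k₀ * (k₀ + 1) ^ j ≤ k ∧ k < k₀ * (k₀ + 1) ^ (j + 1) := by
  have hn : 0 < k / k₀ := Nat.div_pos hk (by omega)
  refine ⟨Nat.log (k₀ + 1) (k / k₀), ?_, ?_⟩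
  · calc k₀ * (k₀ + 1) ^ Nat.log (k₀ + 1) (k / k₀) ≤ k₀ * (k / k₀) :=
          Nat.mul_le_mul_left _ (Nat.pow_log_le_self _ hn.ne')
      _ ≤ k := Nat.mul_div_le k k₀
  · calc k < k₀ * (k / k₀ + 1) := Nat.lt_mul_div_succ k (by omega)
      _ ≤ k₀ * (k₀ + 1) ^ (Nat.log (k₀ + 1) (k / k₀) + 1) :=
          Nat.mul_le_mul_left _ (Nat.lt_pow_succ_log_self (by omega) _)

/-- **Criterion ⇒ decay** (the bootstrap, positive `q`): if `k₀ ≥ 2`, `a₀ ≥ 1`, `0 < q`,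
`(k₀+1)² q < 1` and `P(a, k₀ a) ≤ q` for all `a ≥ a₀`, then with `s := log_{k₀+1}(1/q) > 2`,
`P(a, k a) ≤ k₀^s · k^{-(2+(s-2))}` for all `k ≥ 2`, `a ≥ a₀`: for `k < k₀` the bound is `≥ 1`; for
`k ≥ k₀`, sandwich `k₀ (k₀+1)^j ≤ k < k₀ (k₀+1)^{j+1}`, outer monotonicity and the ladder give
`P(a, k a) ≤ q^{j+1} = (1/(k₀+1)^{j+1})^s ≤ (k₀/k)^s`. -/
theorem decay_of_criterion {k₀ a₀ : ℕ} {q : ℝ} (hk₀ : 2 ≤ k₀) (ha₀ : 1 ≤ a₀) (hq : 0 < q)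
    (hθ : ((k₀ : ℝ) + 1) ^ 2 * q < 1)
    (hcrit : ∀ a : ℕ, a₀ ≤ a →
      (bondPercolation (zdGraph 3) (criticalProbI 3)).real E₃⟦a, k₀ * a⟧ ≤ q) :
    ∃ C δ : ℝ, 0 < δ ∧ ∀ k a : ℕ, 2 ≤ k → a₀ ≤ a →
      (bondPercolation (zdGraph 3) (criticalProbI 3)).real E₃⟦a, k * a⟧ ≤ C * (k : ℝ) ^ (-(2 + δ)) := by
  set K : ℝ := (k₀ : ℝ) + 1 with hK
  have hk₀pos : (0 : ℝ) < k₀ := by exact_mod_cast (show 0 < k₀ by omega)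
  have hK1 : 1 < K := by rw [hK]; linarith
  have hK0 : 0 < K := lt_trans one_pos hK1
  set s : ℝ := Real.logb K (1 / q) with hs
  have hKs : K ^ s = 1 / q := Real.rpow_logb hK0 hK1.ne' (by positivity)
  have hs2 : 2 < s := by
    have h1 : K ^ 2 < 1 / q := by rw [lt_div_iff₀ hq]; exact hθ
    exact (Real.rpow_lt_rpow_left_iff hK1).1 (by rwa [Real.rpow_two, hKs])
  have hs0 : 0 ≤ s := by linarith
  have hqK : q = K⁻¹ ^ s := by rw [Real.inv_rpow hK0.le, hKs, one_div, inv_inv]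
  refine ⟨(k₀ : ℝ) ^ s, s - 2, by linarith, fun k a hk ha => ?_⟩
  have hkpos : (0 : ℝ) < k := by exact_mod_cast (show 0 < k by omega)
  have hCk : (k₀ : ℝ) ^ s * (k : ℝ) ^ (-(2 + (s - 2))) = ((k₀ : ℝ) / k) ^ s := by
    rw [show -(2 + (s - 2)) = -s by ring, Real.rpow_neg hkpos.le,
      Real.div_rpow hk₀pos.le hkpos.le, div_eq_mul_inv]
  rw [hCk]
  rcases lt_or_ge k k₀ with hlt | hle
  · -- small ratio `k < k₀`: `P ≤ 1 ≤ (k₀/k)^s`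
    calc (bondPercolation (zdGraph 3) (criticalProbI 3)).real E₃⟦a, k * a⟧ ≤ 1 := measureReal_le_one
      _ ≤ ((k₀ : ℝ) / k) ^ s :=
        Real.one_le_rpow ((one_le_div hkpos).2 (by exact_mod_cast hlt.le)) hs0
  · -- `k ≥ k₀`: sandwich, outer monotonicity, ladder
    obtain ⟨j, hjl, hju⟩ := ratio_sandwich (by omega) hle
    have hmono : (bondPercolation (zdGraph 3) (criticalProbI 3)).real E₃⟦a, k * a⟧ ≤
        (bondPercolation (zdGraph 3) (criticalProbI 3)).real E₃⟦a, k₀ * (k₀ + 1) ^ j * a⟧ :=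
      real_shellThree_anti _ (Nat.le_mul_of_pos_left a (Nat.mul_pos (by omega) (by positivity)))
        (Nat.mul_le_mul_right a hjl)
    have hlad := real_shellThree_ladder (q := q) (show 1 ≤ k₀ by omega) ha₀ hcrit j a ha
    have hju' : (k : ℝ) < k₀ * K ^ (j + 1) := by rw [hK]; exact_mod_cast hju
    have hbase : (K ^ (j + 1))⁻¹ ≤ (k₀ : ℝ) / k := by
      rw [inv_eq_one_div, div_le_div_iff₀ (by positivity) hkpos]
      linarith
    calc (bondPercolation (zdGraph 3) (criticalProbI 3)).real E₃⟦a, k * a⟧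
        ≤ (bondPercolation (zdGraph 3) (criticalProbI 3)).real E₃⟦a, k₀ * (k₀ + 1) ^ j * a⟧ := hmono
      _ ≤ q ^ (j + 1) := hlad
      _ = ((K ^ (j + 1))⁻¹) ^ s := by
          rw [hqK, Real.rpow_pow_comm (inv_nonneg.2 hK0.le), inv_pow]
      _ ≤ ((k₀ : ℝ) / k) ^ s := Real.rpow_le_rpow (by positivity) hbase hs0

end ShellThreeCalibration

open ShellThreeCalibration in
/-- **Calibration of the one-ratio three-crosser criterion.** At `p_c(ℤ³)`, the finite-ratio
criterion of line `avoidance-cost-covering` — some ratio `k₀ ≥ 2`, scale `a₀ ≥ 1` and `q` with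
`(k₀+1)² q < 1` bound the probability of three shell-distinct crossers of `Sh(a, k₀ a)` for every
`a ≥ a₀` — holds if and only if that probability decays in the ratio `k`, uniformly in `a ≥ a₀`,
like `C k^{-(2+δ)}` for some `δ > 0` ("`ζ₃ > 2`"). (⇒) the multiscale bootstrap
(`ShellThreeCalibration.decay_of_criterion`, after making `q` positive); (⇐) pick `k₀` large
(`ShellThreeCalibration.exists_ratio`) and `q := C k₀^{-(2+δ)}`. -/
theorem oneRatioThreeCrossers_iff_shellThreeCrosserDecay :
    (∃ k₀ a₀ : ℕ, ∃ q : ℝ, 2 ≤ k₀ ∧ 1 ≤ a₀ ∧ ((k₀ : ℝ) + 1) ^ 2 * q < 1 ∧ ∀ a : ℕ, a₀ ≤ a →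
      (bondPercolation (zdGraph 3) (criticalProbI 3)).real
        {ω | ∃ x : Fin (2 + 1) → Site 3, (∀ i, x i ∈ box 3 a) ∧
          (∀ i, ∃ y ∈ innerBoundary (zdGraph 3) (box 3 (k₀ * a)),
            ω ∈ openConnIn {v : Site 3 | v ∈ box 3 (k₀ * a) ∧ ∃ l : Fin 3, (a : ℤ) ≤ |v l|} (x i) y) ∧
          ∀ i j, i ≠ j →
            ω ∉ openConnIn {v : Site 3 | v ∈ box 3 (k₀ * a) ∧ ∃ l : Fin 3, (a : ℤ) ≤ |v l|} (x i) (x j)}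
        ≤ q) ↔
    (∃ a₀ : ℕ, ∃ C δ : ℝ, 1 ≤ a₀ ∧ 0 < δ ∧ ∀ k a : ℕ, 2 ≤ k → a₀ ≤ a →
      (bondPercolation (zdGraph 3) (criticalProbI 3)).real
        {ω | ∃ x : Fin (2 + 1) → Site 3, (∀ i, x i ∈ box 3 a) ∧
          (∀ i, ∃ y ∈ innerBoundary (zdGraph 3) (box 3 (k * a)),
            ω ∈ openConnIn {v : Site 3 | v ∈ box 3 (k * a) ∧ ∃ l : Fin 3, (a : ℤ) ≤ |v l|} (x i) y) ∧
          ∀ i j, i ≠ j →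
            ω ∉ openConnIn {v : Site 3 | v ∈ box 3 (k * a) ∧ ∃ l : Fin 3, (a : ℤ) ≤ |v l|} (x i) (x j)}
        ≤ C * (k : ℝ) ^ (-(2 + δ))) := by
  constructor
  · rintro ⟨k₀, a₀, q, hk₀, ha₀, hθ, hcrit⟩
    -- w.l.o.g. `q > 0`
    have hKpos : (0 : ℝ) < ((k₀ : ℝ) + 1) ^ 2 := by positivity
    have hq'0 : 0 < max q (1 / (2 * ((k₀ : ℝ) + 1) ^ 2)) :=
      lt_of_lt_of_le (by positivity) (le_max_right _ _)
    have hθ' : ((k₀ : ℝ) + 1) ^ 2 * max q (1 / (2 * ((k₀ : ℝ) + 1) ^ 2)) < 1 := by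
      rw [mul_max_of_nonneg _ _ hKpos.le]
      refine max_lt hθ ?_
      rw [mul_one_div, div_lt_one (by positivity)]
      linarith
    obtain ⟨C, δ, hδ, hdec⟩ := decay_of_criterion hk₀ ha₀ hq'0 hθ'
      (fun a ha => (hcrit a ha).trans (le_max_left _ _))
    exact ⟨a₀, C, δ, ha₀, hδ, hdec⟩
  · rintro ⟨a₀, C, δ, ha₀, hδ, hdec⟩
    have hC0 : 0 ≤ C := by
      have h := le_trans measureReal_nonneg (hdec 2 a₀ le_rfl le_rfl)
      have hpos : (0 : ℝ) < ((2 : ℕ) : ℝ) ^ (-(2 + δ)) := Real.rpow_pos_of_pos (by norm_num) _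
      by_contra hC
      exact absurd h (not_le.2 (mul_neg_of_neg_of_pos (not_le.1 hC) hpos))
    obtain ⟨k₀, hk₀, hlt⟩ := exists_ratio hC0 hδ
    exact ⟨k₀, a₀, C * (k₀ : ℝ) ^ (-(2 + δ)), hk₀, ha₀, hlt, fun a ha => hdec k₀ a hk₀ ha⟩

end Summit.CriticalPhenomena.PercolationContinuityZ3.Theorems.NonProliferation

end
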